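import Summits.QuantumFields.YangMills.Theorems.UnitScaleTiltProp7CovInterpErrorLocalLaplaceEnergy
import HarnessLib

/-!
# Route `UnitScaleTilt`, crux K1 «MinimiserStabilityRegPr» (stmt-QuantumFields-19200), route-R E′ path (α′), (E1-b) covariant, row (hK₂-cov) — F1-cov, T³ COROLLARY WITH ONE ABSOLUTE
# RATE: `Σ_{tdist(z,x₀) ≤ R} hs(Δ_W(φ − φ_H)(z)) ≤ C_E·e^{R∕ℓ_k}·ℓ_k³·M²` at every `RegPr` member, `C_E`, `κ₀` depending only on the (3.35) constants `c35, a₅`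

Cell `ym3-torus`, width seat `ym3-torus-px4` (gen 3); sequel of ✓ `Prop7CovInterpErrorLocalLaplaceEnergy` (p674172, ★routeR-w3 g6 word (9b)); covariant twin of px7's ✓
`Prop7InterpErrorLocalLaplaceEnergy.sum_ball_sq_laplace_interp_error_le_T3`.  THEOREMS ONLY (0 `def`, 0 `sorry`); `--supports stmt-QuantumFields-19200`, count-neutral.  YM₃ on
T³ is a ladder rung (R3), not the Clay problem; nothing here claims a stub, the crux, d = 4 or the mass gap.

THE POINT.  ✓ `sum_ball_hs_covLaplace_interp_error_le_member` displays the Agmon rate `κ` with two windows written at the (D1-cov) Poincaré constant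
`A = √(2(κ₁ℓ_k⁴ + (κ₁ℓ_k⁴(2da + 8dτ₁²))²))` (`a = α₀ℓ_k⁻²`, `τ₁ = ηC′e^{ηC′}`, `η = ℓ_k⁻¹`, `C′ = c35·M·α₀ ≤ c35·a₅`).  Since `ℓ_k²·a = α₀ ≤ 1` and `ℓ_k²τ₁² = C′²e^{2C′∕ℓ_k} ≤ T := (c35a₅)²e^{2c35a₅}`,
`A ≤ ℓ_k²·Λ₀` with `Λ₀ := √(2(κ₁ + κ₁²(6 + 24T)²))` ABSOLUTE (d = 3, N = 2), so the rate `κ₀ := min(1∕8, 1∕(400√3·√Λ₀), 1∕(3000Λ₀))` satisfies both windows for every `ℓ_k ≥ 1`, and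
`9e^{2κ₀(1+R∕ℓ_k)}(2 + π√3ℓ_k∕(2κ₀))³ ≤ C_E·e^{R∕ℓ_k}·ℓ_k³` with `C_E := 9e·(2 + π√3∕(2κ₀))³`.

WHAT IS PROVED (ns `…Theorems.Prop7CovInterpErrorLocalLaplaceEnergyT3`).  §1 real letters `sq_le_of_window_data` (`A ≤ ℓ_k²Λ₀`), `sq_mul_tau_sq_le` (`ℓ_k²τ₁² ≤ T`), `windows_of_rate`,
`final_constant_le`; §2 ★★★ `sum_ball_hs_covLaplace_interp_error_le_T3` —
`∃ c35 a₅ κ₀ C_E > 0, ∀ member, ∀ α₀ ∈ (0, 1], M·α₀ ≤ a₅ → ∀ W, RegPr → (the (D1-cov) window) → ∀ x₀ R ≥ 0, ∀ φ φ_H (pinned interpolant, Δ_W-biharmonic off the centres), ∀ M_φ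
(hs(Δ_Wφ) ≤ M_φ²), Σ_{tdist(z,x₀) ≤ R} hs(Δ_W(φ − φ_H) z) ≤ C_E·exp(R∕L^{K−n})·(L^{K−n})³·M_φ²`.  Displayed: `RegPr`, `M·α₀ ≤ a₅`, `α₀ ≤ 1`, the (D1-cov) window (ℓ_k-free), pinning,
biharmonicity, datum — NO rate, NO Agmon window.
HONEST SCOPE.  Real-number bookkeeping over ✓p674172; no new estimate.

References: T. Bałaban, CMP 96 (1984) 223–250 [Balaban1984PropagatorsII] ((1.9) p.226); CMP 102 (1985) 277–309 [Balaban1985Variational] ((2) p.278, Prop. 7 p.299).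
-/

set_option autoImplicit false

noncomputable section

open scoped BigOperators Matrix.Norms.L2Operator Matrix

namespace Summit.QuantumFields.YangMills.Theorems.Prop7CovInterpErrorLocalLaplaceEnergyT3

open Literature.MathematicalPhysics.QuantumFieldTheory.Balaban1983to89
open Literature.MathematicalPhysics.QuantumFieldTheory.Balaban1983to89.T3ContinuumYM3Torus
open Literature.MathematicalPhysics.QuantumFieldTheory.Balaban1983to89.T3PrintedRegularMinimiser (RegPr)
open Literature.MathematicalPhysics.QuantumFieldTheory.Balaban1983to89.B6GlobalChartV1 (PV)
open B9Eq39Adjoint (covD divB)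
open B9TorusCalculus (torusT)
open B10Eq27TorusAxialLog (unitsField toUField)
open B15DeterminingSets (embIter)
open Summit.QuantumFields.YangMills.Theorems.Prop7SectET3Members (hd3)
open Summit.QuantumFields.YangMills.Theorems.Prop7CovInterpErrorLocalLaplaceEnergy (sum_ball_hs_covLaplace_interp_error_le_member)

/-! ## §1 Real-number letters: `A ≤ ℓ_k²·Λ₀`, the two windows at `κ₀`, the final constant -/

/-- **`2(κ₁ℓ⁴ + (κ₁ℓ⁴(6α₀∕ℓ² + 24τ²))²) ≤ (ℓ²Λ₀)²`** when `ℓ ≥ 1`, `0 ≤ α₀ ≤ 1`, `0 ≤ κ₁` and `ℓ²τ² ≤ T`, with `Λ₀ = √(2(κ₁ + κ₁²(6 + 24T)²))`. [folklore] -/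
theorem sq_le_of_window_data {κ₁ ℓk α₀ τ T : ℝ} (hκ₁ : 0 ≤ κ₁) (hℓk : 1 ≤ ℓk) (hα0 : 0 ≤ α₀) (hα1 : α₀ ≤ 1) (hτ : ℓk ^ 2 * τ ^ 2 ≤ T) :
    2 * (κ₁ * ℓk ^ 4 + (κ₁ * ℓk ^ 4 * (2 * 3 * (α₀ * (ℓk ^ 2)⁻¹) + 8 * 3 * τ ^ 2)) ^ 2)
      ≤ (ℓk ^ 2 * Real.sqrt (2 * (κ₁ + κ₁ ^ 2 * (6 + 24 * T) ^ 2))) ^ 2 := by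
  have hℓ0 : 0 < ℓk := by linarith
  have hΛ : 0 ≤ 2 * (κ₁ + κ₁ ^ 2 * (6 + 24 * T) ^ 2) := by positivity
  set s : ℝ := 2 * 3 * (α₀ * (ℓk ^ 2)⁻¹) + 8 * 3 * τ ^ 2 with hsdef
  have hs : ℓk ^ 2 * s = 6 * α₀ + 24 * (ℓk ^ 2 * τ ^ 2) := by
    rw [hsdef]; field_simp; ring
  have hs0 : 0 ≤ 6 * α₀ + 24 * (ℓk ^ 2 * τ ^ 2) := by positivity
  have hsle : 6 * α₀ + 24 * (ℓk ^ 2 * τ ^ 2) ≤ 6 + 24 * T := by linarith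
  have h2 : (ℓk ^ 2 * s) ^ 2 ≤ (6 + 24 * T) ^ 2 := by rw [hs]; exact pow_le_pow_left₀ hs0 hsle 2
  have eL : 2 * (κ₁ * ℓk ^ 4 + (κ₁ * ℓk ^ 4 * s) ^ 2) = 2 * κ₁ * ℓk ^ 4 + 2 * (κ₁ ^ 2 * ℓk ^ 4) * (ℓk ^ 2 * s) ^ 2 := by ring
  have eR : (ℓk ^ 2 * Real.sqrt (2 * (κ₁ + κ₁ ^ 2 * (6 + 24 * T) ^ 2))) ^ 2 = 2 * κ₁ * ℓk ^ 4 + 2 * (κ₁ ^ 2 * ℓk ^ 4) * (6 + 24 * T) ^ 2 := by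
    rw [mul_pow, Real.sq_sqrt hΛ]; ring
  rw [eL, eR]
  have h3 := mul_le_mul_of_nonneg_left h2 (by positivity : (0 : ℝ) ≤ 2 * (κ₁ ^ 2 * ℓk ^ 4))
  linarith

/-- **`ℓ²·τ₁² ≤ B²e^{2B}`** for `τ₁ = ℓ⁻¹C′e^{ℓ⁻¹C′}`, `0 ≤ C′ ≤ B`, `ℓ ≥ 1`. [folklore] -/
theorem sq_mul_tau_sq_le {ℓk C' B : ℝ} (hℓk : 1 ≤ ℓk) (hC'0 : 0 ≤ C') (hC' : C' ≤ B) :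
    ℓk ^ 2 * (ℓk⁻¹ * C' * Real.exp (ℓk⁻¹ * C')) ^ 2 ≤ B ^ 2 * Real.exp (2 * B) := by
  have hℓ0 : 0 < ℓk := by linarith
  have e1 : ℓk ^ 2 * (ℓk⁻¹ * C' * Real.exp (ℓk⁻¹ * C')) ^ 2 = C' ^ 2 * Real.exp (ℓk⁻¹ * C') ^ 2 := by
    field_simp
  rw [e1, ← Real.exp_nat_mul]
  have h1 : C' ^ 2 ≤ B ^ 2 := pow_le_pow_left₀ hC'0 hC' 2
  have h3 : ℓk⁻¹ * C' ≤ C' := by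
    have hinv1 : ℓk⁻¹ ≤ 1 := inv_le_one_of_one_le₀ hℓk
    have := mul_le_mul_of_nonneg_right hinv1 hC'0
    linarith
  have h2 : Real.exp (((2 : ℕ) : ℝ) * (ℓk⁻¹ * C')) ≤ Real.exp (2 * B) := Real.exp_le_exp.2 (by push_cast; linarith)
  exact mul_le_mul h1 h2 (Real.exp_pos _).le (by positivity)

/-- **The two Agmon windows at the rate `κ₀`**: `κ₀ ≤ 1∕8`, `κ₀ ≤ 1∕(400√3√Λ₀)`, `κ₀ ≤ 1∕(3000Λ₀)` and `X ≤ (ℓ²Λ₀)²` give `(4κ₀∕ℓ)√3·√(√X) ≤ 1∕100` and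
`((16κ₀+32κ₀²)∕ℓ²)·3·√X ≤ 1∕50`. [folklore] -/
theorem windows_of_rate {κ₀ Λ₀ ℓk X : ℝ} (hℓk : 1 ≤ ℓk) (hΛ₀ : 0 < Λ₀) (hκ₀0 : 0 < κ₀) (hκ₀1 : κ₀ ≤ 1 / 8)
    (hκ₀2 : κ₀ ≤ 1 / (400 * Real.sqrt 3 * Real.sqrt Λ₀)) (hκ₀3 : κ₀ ≤ 1 / (3000 * Λ₀)) (hX : X ≤ (ℓk ^ 2 * Λ₀) ^ 2) :
    4 * κ₀ / ℓk * Real.sqrt 3 * Real.sqrt (Real.sqrt X) ≤ 1 / 100 ∧ (16 * κ₀ + 32 * κ₀ ^ 2) / ℓk ^ 2 * 3 * Real.sqrt X ≤ 1 / 50 := by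
  have hℓ0 : 0 < ℓk := by linarith
  have hs3 : 0 < Real.sqrt 3 := Real.sqrt_pos.2 (by norm_num)
  have hsΛ : 0 < Real.sqrt Λ₀ := Real.sqrt_pos.2 hΛ₀
  have hA : Real.sqrt X ≤ ℓk ^ 2 * Λ₀ := by
    rw [← Real.sqrt_sq (by positivity : 0 ≤ ℓk ^ 2 * Λ₀)]
    exact Real.sqrt_le_sqrt hX
  have hsA : Real.sqrt (Real.sqrt X) ≤ ℓk * Real.sqrt Λ₀ := by
    have h1 := Real.sqrt_le_sqrt hA
    rwa [Real.sqrt_mul (by positivity), Real.sqrt_sq hℓ0.le] at h1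
  constructor
  · calc 4 * κ₀ / ℓk * Real.sqrt 3 * Real.sqrt (Real.sqrt X) ≤ 4 * κ₀ / ℓk * Real.sqrt 3 * (ℓk * Real.sqrt Λ₀) :=
          mul_le_mul_of_nonneg_left hsA (by positivity)
      _ = κ₀ * (4 * Real.sqrt 3 * Real.sqrt Λ₀) := by field_simp
      _ ≤ 1 / (400 * Real.sqrt 3 * Real.sqrt Λ₀) * (4 * Real.sqrt 3 * Real.sqrt Λ₀) := mul_le_mul_of_nonneg_right hκ₀2 (by positivity)
      _ = 1 / 100 := by field_simp; norm_num
  · have h16 : 16 * κ₀ + 32 * κ₀ ^ 2 ≤ 20 * κ₀ := by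
      have : κ₀ * κ₀ ≤ 1 / 8 * κ₀ := mul_le_mul_of_nonneg_right hκ₀1 hκ₀0.le
      nlinarith
    calc (16 * κ₀ + 32 * κ₀ ^ 2) / ℓk ^ 2 * 3 * Real.sqrt X ≤ (16 * κ₀ + 32 * κ₀ ^ 2) / ℓk ^ 2 * 3 * (ℓk ^ 2 * Λ₀) :=
          mul_le_mul_of_nonneg_left hA (by positivity)
      _ = (16 * κ₀ + 32 * κ₀ ^ 2) * (3 * Λ₀) := by field_simp
      _ ≤ 20 * κ₀ * (3 * Λ₀) := mul_le_mul_of_nonneg_right h16 (by positivity)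
      _ = κ₀ * (60 * Λ₀) := by ring
      _ ≤ 1 / (3000 * Λ₀) * (60 * Λ₀) := mul_le_mul_of_nonneg_right hκ₀3 (by positivity)
      _ = 1 / 50 := by field_simp; norm_num

/-- **The final constant**: `9e^{2κ₀(1+R∕ℓ)}(2 + π√3ℓ∕(2κ₀))³ ≤ 9e(2 + π√3∕(2κ₀))³·e^{R∕ℓ}·ℓ³` for `ℓ ≥ 1`, `0 < κ₀ ≤ 1∕8`, `R ≥ 0`. [folklore] -/
theorem final_constant_le {κ₀ ℓk Rb Mφ : ℝ} (hℓk : 1 ≤ ℓk) (hκ₀0 : 0 < κ₀) (hκ₀1 : κ₀ ≤ 1 / 8) (hRb : 0 ≤ Rb) :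
    9 * Real.exp (2 * κ₀ * (1 + Rb / ℓk)) * (2 + Real.pi * Real.sqrt 3 * ℓk / (2 * κ₀)) ^ 3 * Mφ ^ 2
      ≤ 9 * Real.exp 1 * (2 + Real.pi * Real.sqrt 3 / (2 * κ₀)) ^ 3 * Real.exp (Rb / ℓk) * ℓk ^ 3 * Mφ ^ 2 := by
  have hℓ0 : 0 < ℓk := by linarith
  have hπ := Real.pi_pos
  have hexp : Real.exp (2 * κ₀ * (1 + Rb / ℓk)) ≤ Real.exp 1 * Real.exp (Rb / ℓk) := by
    rw [← Real.exp_add]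
    refine Real.exp_le_exp.2 ?_
    have hR0 : 0 ≤ Rb / ℓk := div_nonneg hRb hℓ0.le
    nlinarith
  have hpoly : (2 + Real.pi * Real.sqrt 3 * ℓk / (2 * κ₀)) ^ 3 ≤ (2 + Real.pi * Real.sqrt 3 / (2 * κ₀)) ^ 3 * ℓk ^ 3 := by
    rw [← mul_pow]
    refine pow_le_pow_left₀ (by positivity) ?_ 3
    have e1 : (2 + Real.pi * Real.sqrt 3 / (2 * κ₀)) * ℓk = 2 * ℓk + Real.pi * Real.sqrt 3 * ℓk / (2 * κ₀) := by
      field_simp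
    rw [e1]; linarith
  have hM2 : 0 ≤ Mφ ^ 2 := sq_nonneg _
  calc 9 * Real.exp (2 * κ₀ * (1 + Rb / ℓk)) * (2 + Real.pi * Real.sqrt 3 * ℓk / (2 * κ₀)) ^ 3 * Mφ ^ 2
      ≤ 9 * (Real.exp 1 * Real.exp (Rb / ℓk)) * ((2 + Real.pi * Real.sqrt 3 / (2 * κ₀)) ^ 3 * ℓk ^ 3) * Mφ ^ 2 := by gcongr
    _ = 9 * Real.exp 1 * (2 + Real.pi * Real.sqrt 3 / (2 * κ₀)) ^ 3 * Real.exp (Rb / ℓk) * ℓk ^ 3 * Mφ ^ 2 := by ring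

/-! ## §2 ★★★ The T³ corollary with one absolute rate -/

section Member

variable {ℓ : ℕ} {hL : Odd (ℓ + 1) ∧ 1 < ℓ + 1}

/-- ★★★ **LOCAL `Δ_W`-ENERGY OF THE COVARIANT INTERPOLATION ERROR ON `T³`, ALL CONSTANTS ABSOLUTE** (see the module docstring).
[cite: Balaban1984PropagatorsII, (1.9) p.226; Balaban1985Variational, (2) p.278, Prop. 7 p.299; Balaban1985BackgroundPropagators, (3.35) p.396] -/
theorem sum_ball_hs_covLaplace_interp_error_le_T3 (hℓ4 : 4 ≤ ℓ) :
    ∃ c35 a₅ κ₀ CE : ℝ, 0 < c35 ∧ 0 < a₅ ∧ 0 < κ₀ ∧ 0 < CE ∧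
      ∀ (hℓ : 4 ≤ ℓ) (m : ℕ) (hm : 1 ≤ m) (n K a' R : ℕ) (hk1 : 1 ≤ K - n) (hsize : a' + 3 ≤ m + n) (hM8 : 8 ≤ (ℓ + 1) ^ a')
        (hR2 : 2 * (ℓ + 1) ^ 2 ≤ R) (α₀ : ℝ), 0 < α₀ → α₀ ≤ 1 → ((ℓ + 1 : ℕ) : ℝ) * (((ℓ + 1) ^ a' : ℕ) : ℝ) * α₀ ≤ a₅ →
        ∀ W : GaugeField (PV 2 ℓ m K hd3 hL) 0 (Matrix.specialUnitaryGroup (Fin 2) ℂ),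
          RegPr (⟨ℓ + 1, hL, m, hm⟩ : T3Family) n K α₀ W →
          (4 * 2197 * (24 * 289 * 24576 * 46116) : ℝ) * ((2 : ℕ) : ℝ) ^ 2 * ((((PV 2 ℓ m K hd3 hL).L : ℝ)) ^ (K - n)) ^ 4
              * ((((PV 2 ℓ m K hd3 hL).d : ℝ)) ^ 2 * (4 * ((2 : ℕ) : ℝ) * (α₀ * ((((PV 2 ℓ m K hd3 hL).L : ℝ))⁻¹) ^ (2 * (K - n))) ^ 2
                + (2 * ((((ℓ + 1 : ℕ) : ℝ) ^ (K - n))⁻¹ * ((((ℓ + 1 : ℕ) : ℝ) ^ (K - n))⁻¹ * (c35 * (((ℓ + 1 : ℕ) : ℝ) * (((ℓ + 1) ^ a' : ℕ) : ℝ)) * α₀))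
                    * Real.exp ((((ℓ + 1 : ℕ) : ℝ) ^ (K - n))⁻¹ * (c35 * (((ℓ + 1 : ℕ) : ℝ) * (((ℓ + 1) ^ a' : ℕ) : ℝ)) * α₀)))
                  + 4 * ((((ℓ + 1 : ℕ) : ℝ) ^ (K - n))⁻¹ * (c35 * (((ℓ + 1 : ℕ) : ℝ) * (((ℓ + 1) ^ a' : ℕ) : ℝ)) * α₀)
                    * Real.exp ((((ℓ + 1 : ℕ) : ℝ) ^ (K - n))⁻¹ * (c35 * (((ℓ + 1 : ℕ) : ℝ) * (((ℓ + 1) ^ a' : ℕ) : ℝ)) * α₀))) ^ 2) ^ 2)) ≤ 1 / 4 →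
          ∀ (x₀ : Site (PV 2 ℓ m K hd3 hL) 0) (Rb Mφ : ℝ), 0 ≤ Rb →
            ∀ (φ φH : Site (PV 2 ℓ m K hd3 hL) 0 → Matrix (Fin 2) (Fin 2) ℂ),
              (∀ y : Site (PV 2 ℓ m K hd3 hL) (K - n), φH (embIter (K - n) y) = φ (embIter (K - n) y)) →
              (∀ x ∉ Set.range (embIter (P := PV 2 ℓ m K hd3 hL) (K - n)),
                divB (torusT (PV 2 ℓ m K hd3 hL) 0) (fun κ' z => unitsField (toUField W) ⟨z, κ'⟩)
                  (fun μ => covD (torusT (PV 2 ℓ m K hd3 hL) 0) (fun κ' z => unitsField (toUField W) ⟨z, κ'⟩) μ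
                    (fun y => divB (torusT (PV 2 ℓ m K hd3 hL) 0) (fun κ' z => unitsField (toUField W) ⟨z, κ'⟩)
                      (fun ν => covD (torusT (PV 2 ℓ m K hd3 hL) 0) (fun κ' z => unitsField (toUField W) ⟨z, κ'⟩) ν φH) y)) x = 0) →
              (∀ z, ∑ j : Fin 2, ∑ k : Fin 2, ‖(divB (torusT (PV 2 ℓ m K hd3 hL) 0) (fun κ' z => unitsField (toUField W) ⟨z, κ'⟩)
                  (fun μ => covD (torusT (PV 2 ℓ m K hd3 hL) 0) (fun κ' z => unitsField (toUField W) ⟨z, κ'⟩) μ φ) z) j k‖ ^ 2 ≤ Mφ ^ 2) →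
              ∑ z ∈ Finset.univ.filter (fun z : Site (PV 2 ℓ m K hd3 hL) 0 => (Site.tdist z x₀ : ℝ) ≤ Rb),
                  ∑ j : Fin 2, ∑ k : Fin 2, ‖(divB (torusT (PV 2 ℓ m K hd3 hL) 0) (fun κ' z => unitsField (toUField W) ⟨z, κ'⟩)
                    (fun μ => covD (torusT (PV 2 ℓ m K hd3 hL) 0) (fun κ' z => unitsField (toUField W) ⟨z, κ'⟩) μ (fun x => φ x - φH x)) z) j k‖ ^ 2
                ≤ CE * Real.exp (Rb / (((ℓ + 1 : ℕ) : ℝ) ^ (K - n))) * ((((ℓ + 1 : ℕ) : ℝ) ^ (K - n))) ^ 3 * Mφ ^ 2 := by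
  obtain ⟨c35, a₅, hc35, ha₅, H⟩ := sum_ball_hs_covLaplace_interp_error_le_member (hL := hL) hℓ4
  -- absolute constants
  obtain ⟨κ₁, hκ₁⟩ : ∃ κ₁ : ℝ, κ₁ = (4 * 2197 * (24 * 289 * 24576 * 46116) : ℝ) * ((2 : ℕ) : ℝ) ^ 2 := ⟨_, rfl⟩
  have hκ₁0 : 0 ≤ κ₁ := by rw [hκ₁]; positivity
  have hκ₁1 : 0 < κ₁ := by rw [hκ₁]; positivity
  obtain ⟨T, hT⟩ : ∃ T : ℝ, T = (c35 * a₅) ^ 2 * Real.exp (2 * (c35 * a₅)) := ⟨_, rfl⟩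
  obtain ⟨Λ₀, hΛ₀⟩ : ∃ Λ₀ : ℝ, Λ₀ = Real.sqrt (2 * (κ₁ + κ₁ ^ 2 * (6 + 24 * T) ^ 2)) := ⟨_, rfl⟩
  have hΛ₀0 : 0 < Λ₀ := by rw [hΛ₀]; exact Real.sqrt_pos.2 (by positivity)
  have hs3 : 0 < Real.sqrt 3 := Real.sqrt_pos.2 (by norm_num)
  have hsΛ : 0 < Real.sqrt Λ₀ := Real.sqrt_pos.2 hΛ₀0
  obtain ⟨κ₀, hκ₀⟩ : ∃ κ₀ : ℝ, κ₀ = min (1 / 8) (min (1 / (400 * Real.sqrt 3 * Real.sqrt Λ₀)) (1 / (3000 * Λ₀))) := ⟨_, rfl⟩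
  have hκ₀0 : 0 < κ₀ := by rw [hκ₀]; exact lt_min (by norm_num) (lt_min (by positivity) (by positivity))
  have hκ₀1 : κ₀ ≤ 1 / 8 := by rw [hκ₀]; exact min_le_left _ _
  have hκ₀2 : κ₀ ≤ 1 / (400 * Real.sqrt 3 * Real.sqrt Λ₀) := by rw [hκ₀]; exact (min_le_right _ _).trans (min_le_left _ _)
  have hκ₀3 : κ₀ ≤ 1 / (3000 * Λ₀) := by rw [hκ₀]; exact (min_le_right _ _).trans (min_le_right _ _)
  refine ⟨c35, a₅, κ₀, 9 * Real.exp 1 * (2 + Real.pi * Real.sqrt 3 / (2 * κ₀)) ^ 3, hc35, ha₅, hκ₀0, by positivity, ?_⟩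
  intro hℓ m hm n K a' R hk1 hsize hM8 hR2 α₀ hα₀ hα1 hMα W hreg hwinD x₀ Rb Mφ hRb φ φH hH hEL hφ
  -- the scale `ℓ_k` and the letters `C′`, `τ₁`
  obtain ⟨ℓk, hℓk⟩ : ∃ ℓk : ℝ, ℓk = ((ℓ + 1 : ℕ) : ℝ) ^ (K - n) := ⟨_, rfl⟩
  have hℓk1 : 1 ≤ ℓk := by rw [hℓk]; exact one_le_pow₀ (by exact_mod_cast Nat.succ_le_succ (Nat.zero_le ℓ))
  have hℓk0 : 0 < ℓk := by linarith
  obtain ⟨C', hC'⟩ : ∃ C' : ℝ, C' = c35 * (((ℓ + 1 : ℕ) : ℝ) * (((ℓ + 1) ^ a' : ℕ) : ℝ)) * α₀ := ⟨_, rfl⟩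
  have hC'0 : 0 ≤ C' := by rw [hC']; positivity
  have hC'le : C' ≤ c35 * a₅ := by
    rw [hC', mul_assoc]; exact mul_le_mul_of_nonneg_left hMα hc35.le
  have hτT : ℓk ^ 2 * (ℓk⁻¹ * C' * Real.exp (ℓk⁻¹ * C')) ^ 2 ≤ T := by rw [hT]; exact sq_mul_tau_sq_le hℓk1 hC'0 hC'le
  have hX := sq_le_of_window_data hκ₁0 hℓk1 hα₀.le hα1 hτT
  rw [← hΛ₀] at hX
  obtain ⟨hw1, hw2⟩ := windows_of_rate hℓk1 hΛ₀0 hκ₀0 hκ₀1 hκ₀2 hκ₀3 hX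
  -- the member row at the rate `κ₀`, letters normalised
  have hdr : (((PV 2 ℓ m K hd3 hL).d : ℝ)) = 3 := by
    show (((2 + 1 : ℕ)) : ℝ) = 3; norm_num
  have hinv : ((((ℓ + 1 : ℕ) : ℝ))⁻¹) ^ (2 * (K - n)) = (ℓk ^ 2)⁻¹ := by
    rw [inv_pow, pow_mul', hℓk]
  have H1 := H hℓ m hm n K a' R hk1 hsize hM8 hR2 α₀ hα₀ hMα W hreg hwinD x₀ κ₀ Rb Mφ hκ₀0 hκ₀1
  simp only [hdr, hinv, ← hℓk, ← hC', ← hκ₁, Nat.reduceAdd] at H1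
  have H2 := H1 hw1 hw2 φ φH hH hEL hφ
  rw [← hℓk]
  exact H2.trans (final_constant_le hℓk1 hκ₀0 hκ₀1 hRb)

end Member

end Summit.QuantumFields.YangMills.Theorems.Prop7CovInterpErrorLocalLaplaceEnergyT3

end
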